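import Summits.QuantumFields.YangMills.Theorems.IR.TypFormatWindowOne
import HarnessLib

/-!
# Crux `IR` (stmt-QuantumFields-19354), lane B: GRADE ROBUSTNESS OF THE TYPICAL ONSET MESH `mixOnsetUc` (the slot's scale-axis quantity)

Helper module for item `stmt-QuantumFields-19354` (`--supports`; it closes nothing).  By-name corollaries of the typical bootstrap ∕ coarsening for the slot's
onset mesh `AfPincerUc.mixOnsetUc ρ β n ε δ = fmtOnset (TypShellCondUKPc ρ · · n ε δ) β` (`Theorems/IR/AfPincerUcFormat.lean` :245; the quantity pinned by X^c
`AFToOnsetUKPc` and by THE NUMBER's scale axis), the Typ twins of g6's `mixOnset_grade_robust` for the universal onset: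

* `mixOnsetUc_antitone` — larger threshold ∕ rarity budget ⇒ smaller onset mesh.
* ★ `mixOnsetUc_window_le` — `mixOnsetUc ρ β (j(2n+1)) ε' δ ≤ mixOnsetUc ρ β n ε δ₀` once `(εM)^j + j(2+3ε)Mδ₀ ≤ ε'`, `0 < δ₀ ≤ δ` (window bootstrap AT the onset mesh).
* ★ `mixOnsetUc_coarsen_le` — `mixOnsetUc ρ β 1 ε' δ ≤ j(2n+1) · mixOnsetUc ρ β n ε δ₀` once `P⁴((εM)^j + j(2+3ε)Mδ₀ + δ₀) ≤ ε'`, `P⁴δ₀ ≤ δ`, `P = 2j(2n+1)+1`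
  (mesh coarsening AT the onset mesh): the typical onset mesh is grade-robust up to the β-INDEPENDENT factor `j(2n+1)` and a β-independent budget rescaling.

HONEST FRAMING: bookkeeping about an OPEN statement's scale-axis quantity; nothing asserts where the onset is, a gap or Clay.  No `sorry`;
axioms ⊆ {propext, Classical.choice, Quot.sound}.
-/

set_option autoImplicit false

noncomputable section

open MeasureTheory
open Literature.MathematicalPhysics
open Literature.MathematicalPhysics.QuantumFieldTheory Literature.MathematicalPhysics.QuantumLattice
open Summit.QuantumFields.YangMills.Cruxes.IR.OnsetFormats (shellCount)
open Summit.QuantumFields.YangMills.Cruxes.IR.OnsetFormatsUc.TypBootstrap (typShellCondUKPc_mono)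
open Summit.QuantumFields.YangMills.Cruxes.IR.OnsetFormatsUc.TypCoarsen (typShellCondUKPc_coarsen)
open Summit.QuantumFields.YangMills.Cruxes.IR.AfPincerUc.SharpOnset (typShellCondUKPc_point_robust)

namespace Summit.QuantumFields.YangMills.Cruxes.IR.AfPincerUc.TypOnsetMesh

open Summit.QuantumFields.YangMills.Cruxes.IR.AfPincerUc

variable {G : Type} [Group G] [TopologicalSpace G] [IsTopologicalGroup G] [CompactSpace G]
  [MeasurableSpace G] [BorelSpace G] {N : ℕ} {ρ : G →* Matrix (Fin N) (Fin N) ℂ}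

/-- The onset mesh is a mesh at which the format holds, as soon as it holds at some mesh (slot currency). -/
theorem mixOnsetUc_spec {β : ℝ} {n : ℕ} {ε δ : ℝ} (hne : ∃ b : ℕ, 1 ≤ b ∧ TypShellCondUKPc ρ β b n ε δ) :
    1 ≤ mixOnsetUc ρ β n ε δ ∧ TypShellCondUKPc ρ β (mixOnsetUc ρ β n ε δ) n ε δ := by
  obtain ⟨b, hb, hT⟩ := hne
  exact fmtOnset_spec (fun β' b' => TypShellCondUKPc ρ β' b' n ε δ) β ⟨b, hb, hT⟩

/-- **Antitonicity**: a larger threshold and a larger rarity budget can only lower the onset mesh (`0 ≤ δ ≤ δ'`, `ε ≤ ε'`; format at some mesh). -/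
theorem mixOnsetUc_antitone {β : ℝ} {n : ℕ} {ε ε' δ δ' : ℝ} (hεε' : ε ≤ ε') (hδ : 0 ≤ δ) (hδδ' : δ ≤ δ')
    (hne : ∃ b : ℕ, 1 ≤ b ∧ TypShellCondUKPc ρ β b n ε δ) : mixOnsetUc ρ β n ε' δ' ≤ mixOnsetUc ρ β n ε δ := by
  obtain ⟨h1, hT⟩ := mixOnsetUc_spec hne
  refine fmtOnset_le (fun β' b' => TypShellCondUKPc ρ β' b' n ε' δ') β h1 ?_
  exact (typShellCondUKPc_iff_mirror ρ β _ n ε' δ').mpr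
    (typShellCondUKPc_mono ρ hεε' hδ hδδ' ((typShellCondUKPc_iff_mirror ρ β _ n ε δ).mp hT))

variable [SecondCountableTopology G] [T2Space G]

/-- **Window bootstrap AT the onset mesh**: for continuous `ρ`, `0 ≤ ε`, `ε·shellCount n ≤ 1`, `0 < δ₀ ≤ δ`, `(ε·shellCount n)^j + j(2+3ε)·shellCount n·δ₀ ≤ ε'`
and the format at some mesh at budget `δ₀`: `mixOnsetUc ρ β (j(2n+1)) ε' δ ≤ mixOnsetUc ρ β n ε δ₀`. -/
theorem mixOnsetUc_window_le (hρ : Continuous ρ) {β : ℝ} {n : ℕ} {ε ε' δ₀ δ : ℝ} (hε : 0 ≤ ε) (hεM : ε * shellCount n ≤ 1)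
    (hδ₀ : 0 < δ₀) (hδ₀δ : δ₀ ≤ δ) (j : ℕ) (hε' : (ε * shellCount n) ^ j + (j : ℝ) * ((2 + 3 * ε) * shellCount n * δ₀) ≤ ε')
    (hne : ∃ b : ℕ, 1 ≤ b ∧ TypShellCondUKPc ρ β b n ε δ₀) :
    mixOnsetUc ρ β (j * (2 * n + 1)) ε' δ ≤ mixOnsetUc ρ β n ε δ₀ := by
  obtain ⟨h1, hT⟩ := mixOnsetUc_spec hne
  exact fmtOnset_le (fun β' b' => TypShellCondUKPc ρ β' b' (j * (2 * n + 1)) ε' δ) β h1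
    (typShellCondUKPc_point_robust hρ h1 hε hεM hδ₀ hδ₀δ j hε' hT)

/-- **Mesh coarsening AT the onset mesh**: for continuous `ρ`, `0 ≤ ε`, `ε·shellCount n ≤ 1`, `0 < δ₀`, `j ≥ 1`, `P = 2j(2n+1)+1`, `P⁴·δ₀ ≤ δ`,
`P⁴·((ε·shellCount n)^j + j(2+3ε)·shellCount n·δ₀ + δ₀) ≤ ε'` and the format at some mesh at budget `δ₀`:
`mixOnsetUc ρ β 1 ε' δ ≤ j(2n+1) · mixOnsetUc ρ β n ε δ₀` — the typical onset mesh at window `1` is at most a β-INDEPENDENT multiple of the onset mesh at grade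
`(n, ε)`, after a β-independent budget rescaling. -/
theorem mixOnsetUc_coarsen_le (hρ : Continuous ρ) {β : ℝ} {n : ℕ} {ε ε' δ₀ δ : ℝ} (hε : 0 ≤ ε) (hεM : ε * shellCount n ≤ 1) (hδ₀ : 0 < δ₀)
    {j : ℕ} (hj : 1 ≤ j) (hδ : (((2 * (j * (2 * n + 1)) + 1) ^ 4 : ℕ) : ℝ) * δ₀ ≤ δ)
    (hε' : (((2 * (j * (2 * n + 1)) + 1) ^ 4 : ℕ) : ℝ) * ((ε * shellCount n) ^ j + (j : ℝ) * ((2 + 3 * ε) * shellCount n * δ₀) + δ₀) ≤ ε')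
    (hne : ∃ b : ℕ, 1 ≤ b ∧ TypShellCondUKPc ρ β b n ε δ₀) :
    mixOnsetUc ρ β 1 ε' δ ≤ j * (2 * n + 1) * mixOnsetUc ρ β n ε δ₀ := by
  obtain ⟨h1, hT⟩ := mixOnsetUc_spec hne
  set b₀ := mixOnsetUc ρ β n ε δ₀ with hb₀
  set K : ℕ := j * (2 * n + 1) with hK
  have hK1 : 1 ≤ K := le_trans hj (Nat.le_mul_of_pos_right j (by omega))
  have hbB : b₀ ≤ K * b₀ := Nat.le_mul_of_pos_left b₀ (by omega)
  have hdiv : K * b₀ / b₀ = K := Nat.mul_div_cancel K (by omega)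
  have hjK : j * (2 * n + 1) ≤ 2 * (K * b₀ / b₀) := by rw [hdiv, hK]; omega
  have hc := typShellCondUKPc_coarsen ρ hρ h1 hbB hε hεM hδ₀.le j hjK ((typShellCondUKPc_iff_mirror ρ β b₀ n ε δ₀).mp hT)
  rw [hdiv] at hc
  have hc' := typShellCondUKPc_mono ρ hε' (by positivity) hδ hc
  exact fmtOnset_le (fun β' b' => TypShellCondUKPc ρ β' b' 1 ε' δ) β (le_trans h1 hbB)
    ((typShellCondUKPc_iff_mirror ρ β _ 1 ε' δ).mpr hc')

end Summit.QuantumFields.YangMills.Cruxes.IR.AfPincerUc.TypOnsetMesh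

end
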